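import Summits.HodgeConjecture.HodgeConjecture.Theses.TorelliForSymmetries

/-!
# Strategist sketch — the best typed split of `MiddleInvolutions` (stmt-HodgeConjecture-14418)

Decomposition attempt D-A of STRATEGY-CENSUS.md: block split of a middle-degree Hodge involution
along `H^{2n}_B(Y) = Hdg ⊕ Hdg^⊥` (the `P`-orthogonal of the Hodge classes is a sub-Hodge-structure
without Hodge classes; `Hom_HS(Hdg^⊥, ℚ(-n)) = 0`, so `End_HS` is block-diagonal).

* `HodgeBlockInvolutions`  — involutions that are the identity on `Hdg^⊥` (contains every reflection
  `s_v`, `v` a Hodge class, hence ⟹ HC by `ReflectionsDecide`: HC-complete).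
* `TranscendentalInvolutions` — involutions fixing every Hodge class (⟹ HC as well, by the
  `Sym² H¹(E)`-padding / partial-trace argument of the census: HC-complete).
* `SplitAssembly` — the glue `HodgeBlockInvolutions → TranscendentalInvolutions → MiddleInvolutions`
  (needs: block-diagonality of `End_HS` w.r.t. `Hdg ⊕ Hdg^⊥` and composition of inducing
  correspondences — API not in the tree; NOT proved here).

These are TYPED ONLY (they elaborate); nothing is filed: both pieces are individually equivalent to
the summit, so the split fails the redirect certificate (c) "no piece ↔ summit".
-/

namespace Summit.HodgeConjecture.HodgeConjecture.Cruxes.MiddleInvolutions.Strategist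

open Literature.AlgebraicGeometry.Motives CategoryTheory MonoidalCategory
open Summit.HodgeConjecture.HodgeConjecture.Theses.TorelliForSymmetries

/-- Piece 1 (Hodge block): middle-degree Hodge involutions acting as the identity on the
`P`-orthogonal complement of the Hodge classes are induced by algebraic classes on `Y × Y`. -/
def HodgeBlockInvolutions : Prop :=
  ∀ B : BettiHodgeData ℂ, B.IsComparisonCompatible → (∀ ⦃n : ℕ⦄ ⦃X : SchemeOver ℂ⦄ (hX : IsSmoothProjective n X) (hXX : IsSmoothProjective (n + n) (X ⊗ X)) (i j' : ℕ) (hj : i + j' = 2 * n) (φ : HodgeStructure.Hom (B.hodge hX i) (B.hodge hX i)), ∃ u ∈ (B.hodge hXX (2 * n)).hodgeClasses (n : ℤ), B.W.IsInducedBy n n u φ.toLinearMap hj (show i + 2 * n + j' = 2 * (n + n) by omega)) → ∀ ⦃n : ℕ⦄ ⦃Y : SchemeOver ℂ⦄ (hY : IsSmoothProjective (n + n) Y) (φ : HodgeStructure.Hom (B.hodge hY (2 * n)) (B.hodge hY (2 * n))), φ.toLinearMap ∘ₗ φ.toLinearMap = LinearMap.id → ∀ P : (B.hodge hY (2 * n)).Polarization,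 (∀ x : B.W.obj Y (2 * n), (∀ a ∈ (B.hodge hY (2 * n)).hodgeClasses (n : ℤ), P.form x a = 0) → φ.toLinearMap x = x) → ∀ (j' : ℕ) (hj : 2 * n + j' = 2 * (n + n)), ∃ u ∈ B.W.ratAlgebraicClasses (Y ⊗ Y) (n + n), B.W.IsInducedBy (n + n) (n + n) u φ.toLinearMap hj (show 2 * n + 2 * (n + n) + j' = 2 * ((n + n) + (n + n)) by omega)

/-- Piece 2 (transcendental block): middle-degree Hodge involutions FIXING EVERY HODGE CLASS are
induced by algebraic classes on `Y × Y`. -/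
def TranscendentalInvolutions : Prop :=
  ∀ B : BettiHodgeData ℂ, B.IsComparisonCompatible → (∀ ⦃n : ℕ⦄ ⦃X : SchemeOver ℂ⦄ (hX : IsSmoothProjective n X) (hXX : IsSmoothProjective (n + n) (X ⊗ X)) (i j' : ℕ) (hj : i + j' = 2 * n) (φ : HodgeStructure.Hom (B.hodge hX i) (B.hodge hX i)), ∃ u ∈ (B.hodge hXX (2 * n)).hodgeClasses (n : ℤ), B.W.IsInducedBy n n u φ.toLinearMap hj (show i + 2 * n + j' = 2 * (n + n) by omega)) → ∀ ⦃n : ℕ⦄ ⦃Y : SchemeOver ℂ⦄ (hY : IsSmoothProjective (n + n) Y) (φ : HodgeStructure.Hom (B.hodge hY (2 * n)) (B.hodge hY (2 * n))), φ.toLinearMap ∘ₗ φ.toLinearMap = LinearMap.id → (∀ a ∈ (B.hodge hY (2 * n)).hodgeClasses (n : ℤ), φ.toLinearMap a = a) → ∀ (j' : ℕ) (hj : 2 * n + j' = 2 * (n + n)), ∃ u ∈ B.W.ratAlgebraicClasses (Y ⊗ Y) (n + n), B.W.IsInducedBy (n + n) (n + n) u φ.toLinearMap hj (show 2 * n + 2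 * (n + n) + j' = 2 * ((n + n) + (n + n)) by omega)

/-- The glue of split D-A (block-diagonality of `End_HS(H^{2n})` along `Hdg ⊕ Hdg^⊥` + composition
of inducing correspondences). Typed, not proved. -/
def SplitAssembly : Prop :=
  HodgeBlockInvolutions → TranscendentalInvolutions → MiddleInvolutions

/-- Sanity: the parent crux trivially gives both pieces (they are literal weakenings). -/
theorem hodgeBlockInvolutions_of_middleInvolutions (h : MiddleInvolutions) : HodgeBlockInvolutions :=
  fun B hB K n Y hY φ hφ _P _hfix j' hj => h B hB K hY φ hφ j' hj

theorem transcendentalInvolutions_of_middleInvolutions (h : MiddleInvolutions) :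
    TranscendentalInvolutions :=
  fun B hB K n Y hY φ hφ _hfix j' hj => h B hB K hY φ hφ j' hj

end Summit.HodgeConjecture.HodgeConjecture.Cruxes.MiddleInvolutions.Strategist
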